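import Literature.Topology.FourManifolds.TrisectionsMiddleCharts
import HarnessLib

/-!
# A boundary-adapted function on the first sector `X₁` (towards "`X₁ ≅ ♮ᵏ S¹ × B³`", Gay–Kirby
# 2016, Lemma 14): the function and its first-order behaviour

Topic `Literature/Topology/FourManifolds`; for the fact seat
`provefact-Literature.Topology.FourManifolds.exists_isBalancedGKTrisection` (Gay–Kirby 2016,
Thm. 4 via Lemma 14).  Everything in this file is **proved**; no named facts are introduced.

Clause (ii) of the corrected trisection predicate asks for a handle decomposition of the first
sector `X₁ = {F₁ ≤ 0}` (`BevelData.sector`, the sublevel set `{f ≤ 3/2}` bevelled along the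
central surface `F`) *with its straightened structure* (`BevelData.cornerSliceAtlas`); by
`CornerSliceAtlas.hasHandleDecomposition_of_comp_val` (`TrisectionsSectorMorse.lean`) this is
produced by a function `F` on the ambient manifold which is `1` on `∂X₁`, `< 1` inside,
regular on `∂X₁ ∖ F`, of *corner form* `G(2uv, v² - u², ·)` near `F`, and Morse inside.  Gay
and Kirby: "`X₁` … [is] diffeomorphic to `♮ᵏ S¹ × B³`" (proof of Lemma 14) — for the union of
the `0`- and `1`-handles this is the upside-down reading of the Morse function `f` below `3/2`;
the work here is forced by the corners.  This file constructs the function and establishes its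
first-order behaviour; the Morse data and the handle decomposition are assembled in a sequel.

**The function.**  With the two smooth face functions `U = -Ft 1 = -s - κ χ₁(s) χ₂(r) r`,
`V = -Ft (-1) = -s + κ χ₁(s) χ₂(r) r` of `TrisectionsBevelledSector.lean` one has
`X₁ = {U ≥ 0} ∩ {V ≥ 0}`, `U + V = -2s`, `∂X₁ ∩ {r ≥ 0} = {U = 0}`, `∂X₁ ∩ {r ≤ 0} = {V = 0}`,
and near `F` `(U, V) = (u, v)` are the normal coordinates of the corner charts.  Put

`F = 1 - (U V W(r) + (1 - w₊(r)) U m(s) + (1 - w₋(r)) V m(s)) / m(s)` on the band `|s| < δ_U`,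
`F = 1 + s` below it,

where `m(s) = plateauAbs c ε' s` is a smoothing of `max (c, |s|)` (constant `c` for
`|s| ≤ c - ε'`, equal to `|s|` for `|s| ≥ c + ε'`, slope at most `1`), `w₊` (`w₋`) is a
cut-off equal to `1` for `r ≤ ε_w` (`-r ≤ ε_w`) and to `0` for `r ≥ 2ε_w` (`-r ≥ 2ε_w`), and
`W = w₊ + w₋ - 1`.  Thus `F = 1 - U V / c = 1 - x₀/(2c)` in the corner charts (corner form),
`F = 1 - U · (positive)` on `{r > 0}` and `1 - V · (positive)` on `{r < 0}` (so `F = 1`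
exactly on `∂X₁`, `< 1` inside, regular on `∂X₁ ∖ F`), and `F = 1 + s = f - a + 1` below the
collar (so that the interior critical points of `F` are those of `f`, with the same Hessians).
Inside the collar `F` strictly increases along the unit-speed flow (no critical points there),
provided the bevel slope `κ` is small against the slope of the bump `χ₁`
(`SectorOneParams.hκ : κ · sup|χ₁'| · rOut₂ ≤ 1/4`).

## References

* D. Gay, R. Kirby, *Trisecting 4-manifolds*, Geom. Topol. 20 (2016) 3097–3132
  (arXiv:1205.1565): Def. 1; §4, Lemma 14 and its proof. [GayKirby2016]
* J. Milnor, *Morse theory* (1963), Thm. 3.1 and §3 (`Mᵃ` and `f|Mᵃ`). [Milnor1963]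
-/

open scoped Manifold ContDiff Topology
open Set Function Filter Real

noncomputable section

universe u

namespace Literature.Topology.FourManifolds

/-! ### A plateau smoothing of `|s|` -/

section Plateau

variable (c ε : ℝ)

/-- **The plateau smoothing of `max (c, |s|)`**: `c + σ_ε(s - c) + σ_ε(-s - c)` with the crease
profile `σ_ε` (`creaseσ`): even, smooth, `= c` for `|s| ≤ c - ε`, `= |s|` for `|s| ≥ c + ε`,
`≥ max (c, |s|)`, with slope in `[-1, 1]`. [folklore] -/
def plateauAbs (s : ℝ) : ℝ := c + creaseσ ε (s - c) + creaseσ ε (-s - c)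

variable {c ε} (hε : 0 < ε) (hcε : ε ≤ c)

/-- The plateau smoothing is smooth. [folklore] -/
theorem contDiff_plateauAbs : ContDiff ℝ ∞ (plateauAbs c ε) :=
  (contDiff_const.add ((contDiff_creaseσ ε).comp (contDiff_id.sub contDiff_const))).add
    ((contDiff_creaseσ ε).comp (contDiff_neg.sub contDiff_const))

include hε hcε in
/-- For `s ≥ 0` the second crease term vanishes. [folklore] -/
theorem plateauAbs_of_nonneg {s : ℝ} (hs : 0 ≤ s) : plateauAbs c ε s = c + creaseσ ε (s - c) := by
  rw [plateauAbs, creaseσ_of_le_neg hε (w := -s - c) (by linarith), add_zero]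

include hε hcε in
/-- For `s ≤ 0` the first crease term vanishes. [folklore] -/
theorem plateauAbs_of_nonpos {s : ℝ} (hs : s ≤ 0) : plateauAbs c ε s = c + creaseσ ε (-s - c) := by
  rw [plateauAbs, creaseσ_of_le_neg hε (w := s - c) (by linarith), add_zero]

include hε hcε in
/-- The plateau smoothing in terms of `|s|`. [folklore] -/
theorem plateauAbs_eq_abs (s : ℝ) : plateauAbs c ε s = c + creaseσ ε (|s| - c) := by
  rcases le_total 0 s with hs | hs
  · rw [plateauAbs_of_nonneg hε hcε hs, abs_of_nonneg hs]
  · rw [plateauAbs_of_nonpos hε hcε hs, abs_of_nonpos hs]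

include hε hcε in
/-- **On the plateau** `|s| ≤ c - ε` the smoothing is the constant `c`. [folklore] -/
theorem plateauAbs_of_abs_le {s : ℝ} (hs : |s| ≤ c - ε) : plateauAbs c ε s = c := by
  rw [plateauAbs_eq_abs hε hcε, creaseσ_of_le_neg hε (by linarith), add_zero]

include hε hcε in
/-- **Off the plateau** (`c + ε ≤ |s|`) the smoothing is `|s|`. [folklore] -/
theorem plateauAbs_of_le_abs {s : ℝ} (hs : c + ε ≤ |s|) : plateauAbs c ε s = |s| := by
  rw [plateauAbs_eq_abs hε hcε, creaseσ_of_le hε (by linarith)]; ring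

include hε hcε in
/-- `max (c, |s|) ≤ plateauAbs c ε s`. [folklore] -/
theorem max_le_plateauAbs (s : ℝ) : max c |s| ≤ plateauAbs c ε s := by
  rw [plateauAbs_eq_abs hε hcε]
  have h := max_le_creaseσ hε (|s| - c)
  have h1 : |s| - c ≤ creaseσ ε (|s| - c) := (le_max_left _ _).trans h
  have h2 : 0 ≤ creaseσ ε (|s| - c) := (le_max_right _ _).trans h
  exact max_le (by linarith) (by linarith)

include hε hcε in
/-- `|s| ≤ plateauAbs c ε s`. [folklore] -/
theorem abs_le_plateauAbs (s : ℝ) : |s| ≤ plateauAbs c ε s := (le_max_right _ _).trans (max_le_plateauAbs hε hcε s)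

include hε hcε in
/-- `c ≤ plateauAbs c ε s`. [folklore] -/
theorem le_plateauAbs (s : ℝ) : c ≤ plateauAbs c ε s := (le_max_left _ _).trans (max_le_plateauAbs hε hcε s)

include hε hcε in
/-- The plateau smoothing is positive (`c ≥ ε > 0`). [folklore] -/
theorem plateauAbs_pos (s : ℝ) : 0 < plateauAbs c ε s := (hε.trans_le hcε).trans_le (le_plateauAbs hε hcε s)

include hε in
/-- **The derivative of the plateau smoothing**: `σ_ε'(s - c) - σ_ε'(-s - c)`, a difference of
two crease steps. [folklore] -/
theorem hasDerivAt_plateauAbs (s : ℝ) :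
    HasDerivAt (plateauAbs c ε) (creaseStep ((s - c) / ε) - creaseStep ((-s - c) / ε)) s := by
  have h1 : HasDerivAt (fun x => creaseσ ε (x - c)) (creaseStep ((s - c) / ε)) s :=
    (hasDerivAt_creaseσ hε (s - c)).comp_sub_const s c
  have h2 : HasDerivAt (fun x => creaseσ ε (-c - x)) (-creaseStep ((-c - s) / ε)) s :=
    (hasDerivAt_creaseσ hε (-c - s)).comp_const_sub (-c) s
  have h := ((hasDerivAt_const s c).add h1).add h2
  have hfun : plateauAbs c ε = ((fun _ => c) + fun x => creaseσ ε (x - c)) + fun x => creaseσ ε (-c - x) := by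
    funext x; simp only [plateauAbs, Pi.add_apply]; ring_nf
  rw [hfun]
  refine h.congr_deriv ?_
  rw [show -c - s = -s - c by ring]; ring

include hε in
/-- The slope of the plateau smoothing is at most `1` in absolute value. [folklore] -/
theorem abs_deriv_plateauAbs_le (s : ℝ) : |deriv (plateauAbs c ε) s| ≤ 1 := by
  rw [(hasDerivAt_plateauAbs hε s).deriv]
  have h1 := creaseStep_nonneg ((s - c) / ε)
  have h2 := creaseStep_le_one ((s - c) / ε)
  have h3 := creaseStep_nonneg ((-s - c) / ε)
  have h4 := creaseStep_le_one ((-s - c) / ε)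
  rw [abs_le]; constructor <;> linarith

include hε hcε in
/-- For `s ≤ 0` the slope of the plateau smoothing is `≤ 0` (the smoothing increases with
`|s|`). [folklore] -/
theorem deriv_plateauAbs_nonpos {s : ℝ} (hs : s ≤ 0) : deriv (plateauAbs c ε) s ≤ 0 := by
  rw [(hasDerivAt_plateauAbs hε s).deriv, creaseStep_of_le_neg_one (by
    rw [div_le_iff₀ hε]; linarith), zero_sub, neg_nonpos]
  exact creaseStep_nonneg _

include hε in
/-- On the plateau the slope vanishes. [folklore] -/
theorem deriv_plateauAbs_of_abs_lt {s : ℝ} (hs : |s| < c - ε) : deriv (plateauAbs c ε) s = 0 := by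
  rw [(hasDerivAt_plateauAbs hε s).deriv]
  have h1 : (s - c) / ε ≤ -1 := by rw [div_le_iff₀ hε]; linarith [le_abs_self s]
  have h2 : (-s - c) / ε ≤ -1 := by rw [div_le_iff₀ hε]; linarith [neg_abs_le s]
  rw [creaseStep_of_le_neg_one h1, creaseStep_of_le_neg_one h2, sub_zero]

end Plateau

/-! ### A downward cut-off -/

section CutDown

variable (r₂ r₃ : ℝ)

/-- **The downward cut-off** `w(r) = smoothTransition ((r₃ - r)/(r₃ - r₂))`: smooth, valued in
`[0, 1]`, `= 1` for `r ≤ r₂`, `= 0` for `r ≥ r₃` (`r₂ < r₃`). [folklore] -/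
def cutDown (r : ℝ) : ℝ := smoothTransition ((r₃ - r) / (r₃ - r₂))

variable {r₂ r₃}

/-- The cut-off is smooth. [folklore] -/
theorem contDiff_cutDown : ContDiff ℝ ∞ (cutDown r₂ r₃) :=
  smoothTransition.contDiff.comp ((contDiff_const.sub contDiff_id).div_const _)

/-- `0 ≤ w`. [folklore] -/
theorem cutDown_nonneg (r : ℝ) : 0 ≤ cutDown r₂ r₃ r := smoothTransition.nonneg _

/-- `w ≤ 1`. [folklore] -/
theorem cutDown_le_one (r : ℝ) : cutDown r₂ r₃ r ≤ 1 := smoothTransition.le_one _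

/-- `w = 1` for `r ≤ r₂` (`r₂ < r₃`). [folklore] -/
theorem cutDown_of_le (h : r₂ < r₃) {r : ℝ} (hr : r ≤ r₂) : cutDown r₂ r₃ r = 1 :=
  smoothTransition.one_of_one_le ((one_le_div (by linarith)).2 (by linarith))

/-- `w = 0` for `r₃ ≤ r` (`r₂ < r₃`). [folklore] -/
theorem cutDown_of_ge (h : r₂ < r₃) {r : ℝ} (hr : r₃ ≤ r) : cutDown r₂ r₃ r = 0 :=
  smoothTransition.zero_of_nonpos (div_nonpos_of_nonpos_of_nonneg (by linarith) (by linarith))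

end CutDown

variable {X : Type u} [TopologicalSpace X] [T2Space X] [CompactSpace X]
  [ChartedSpace (EuclideanSpace ℝ (Fin 4)) X] [IsManifold (𝓡 4) ∞ X]

namespace BiCollar

namespace BevelData

variable {B : BiCollar X} (D : B.BevelData)

/-! ### The face functions `U = -Ft 1`, `V = -Ft (-1)` -/

/-- **The first face function** `U = -s - κ χ₁(s) χ₂(r) r` (`= -Ft 1`; `= u` near `F`).
[cite: GayKirby2016, Def. 1 and Fig. 1] -/
def faceU (x : X) : ℝ := -D.Ft 1 x

/-- **The second face function** `V = -s + κ χ₁(s) χ₂(r) r` (`= -Ft (-1)`; `= v` near `F`).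
[cite: GayKirby2016, Def. 1 and Fig. 1] -/
def faceV (x : X) : ℝ := -D.Ft (-1) x

/-- `U` unfolded. [folklore] -/
theorem faceU_eq (x : X) :
    D.faceU x = -B.sFun x - D.κ * (D.χ₁ (B.sFun x) * (D.χ₂ (B.rFun x) * B.rFun x)) := by
  rw [faceU, Ft]; ring

/-- `V` unfolded. [folklore] -/
theorem faceV_eq (x : X) :
    D.faceV x = -B.sFun x + D.κ * (D.χ₁ (B.sFun x) * (D.χ₂ (B.rFun x) * B.rFun x)) := by
  rw [faceV, Ft]; ring

/-- `U` is smooth. [folklore] -/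
theorem contMDiff_faceU : ContMDiff (𝓡 4) 𝓘(ℝ, ℝ) ∞ D.faceU := (D.contMDiff_Ft 1).neg

/-- `V` is smooth. [folklore] -/
theorem contMDiff_faceV : ContMDiff (𝓡 4) 𝓘(ℝ, ℝ) ∞ D.faceV := (D.contMDiff_Ft (-1)).neg

/-- **`U + V = -2s`.** [folklore] -/
theorem faceU_add_faceV (x : X) : D.faceU x + D.faceV x = -2 * B.sFun x := by
  rw [faceU_eq, faceV_eq]; ring

/-- The bevel term `κ χ₁(s) χ₂(r) |r|` is at most `κ rOut₂`. [folklore] -/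
theorem bevel_term_le (x : X) : D.κ * (D.χ₁ (B.sFun x) * (D.χ₂ (B.rFun x) * |B.rFun x|)) ≤ D.κ * D.χ₂.rOut := by
  have h1 : D.χ₁ (B.sFun x) * (D.χ₂ (B.rFun x) * |B.rFun x|) ≤ D.χ₂.rOut := by
    have := D.χ₂_mul_abs_le (B.rFun x)
    have h0 := D.χ₂_mul_abs_nonneg (B.rFun x)
    calc D.χ₁ (B.sFun x) * (D.χ₂ (B.rFun x) * |B.rFun x|) ≤ 1 * (D.χ₂ (B.rFun x) * |B.rFun x|) :=
          mul_le_mul_of_nonneg_right D.χ₁.le_one h0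
      _ ≤ D.χ₂.rOut := by rw [one_mul]; exact this
  exact mul_le_mul_of_nonneg_left h1 D.κ_pos.le

/-- On `{r ≥ 0}`, `F₁ = -U`. [folklore] -/
theorem F₁_eq_neg_faceU {x : X} (hr : 0 ≤ B.rFun x) : D.F₁ x = -D.faceU x := by
  rw [faceU, neg_neg, D.Ft_eq_F₁ (by rw [one_mul, abs_of_nonneg hr])]

/-- On `{r ≤ 0}`, `F₁ = -V`. [folklore] -/
theorem F₁_eq_neg_faceV {x : X} (hr : B.rFun x ≤ 0) : D.F₁ x = -D.faceV x := by
  rw [faceV, neg_neg, D.Ft_eq_F₁ (by rw [neg_one_mul, abs_of_nonpos hr])]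

/-- `F₁ = max (-U) (-V)` (`= max (Ft 1) (Ft (-1))`, as `|r| = max r (-r)` and the bevel
coefficient is nonnegative). [folklore] -/
theorem F₁_eq_max (x : X) : D.F₁ x = max (-D.faceU x) (-D.faceV x) := by
  rcases le_total 0 (B.rFun x) with hr | hr
  · rw [D.F₁_eq_neg_faceU hr, eq_comm, max_eq_left_iff, faceU_eq, faceV_eq]
    have h0 : 0 ≤ D.κ * (D.χ₁ (B.sFun x) * (D.χ₂ (B.rFun x) * B.rFun x)) :=
      mul_nonneg D.κ_pos.le (mul_nonneg D.χ₁.nonneg (mul_nonneg D.χ₂.nonneg hr))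
    linarith
  · rw [D.F₁_eq_neg_faceV hr, eq_comm, max_eq_right_iff, faceU_eq, faceV_eq]
    have h0 : D.κ * (D.χ₁ (B.sFun x) * (D.χ₂ (B.rFun x) * B.rFun x)) ≤ 0 :=
      mul_nonpos_of_nonneg_of_nonpos D.κ_pos.le
        (mul_nonpos_of_nonneg_of_nonpos D.χ₁.nonneg (mul_nonpos_of_nonneg_of_nonpos D.χ₂.nonneg hr))
    linarith

/-- **`X₁ = {U ≥ 0} ∩ {V ≥ 0}`.** [cite: GayKirby2016, Def. 1 and Fig. 1] -/
theorem mem_sector_iff_face (x : X) : x ∈ D.sector ↔ 0 ≤ D.faceU x ∧ 0 ≤ D.faceV x := by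
  rw [mem_sector_iff, F₁_eq_max, max_le_iff, neg_nonpos, neg_nonpos]

/-- The interior inequality: `F₁ < 0 ↔ U > 0 ∧ V > 0`. [folklore] -/
theorem F₁_neg_iff_face (x : X) : D.F₁ x < 0 ↔ 0 < D.faceU x ∧ 0 < D.faceV x := by
  rw [F₁_eq_max, max_lt_iff, neg_neg_iff_pos, neg_neg_iff_pos]

/-- The boundary equation: `F₁ = 0` iff (`U = 0` and `V ≥ 0`) or (`V = 0` and `U ≥ 0`). [folklore] -/
theorem F₁_eq_zero_iff_face (x : X) :
    D.F₁ x = 0 ↔ (D.faceU x = 0 ∧ 0 ≤ D.faceV x) ∨ (D.faceV x = 0 ∧ 0 ≤ D.faceU x) := by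
  rw [F₁_eq_max]
  constructor
  · intro h
    rcases le_total (-D.faceU x) (-D.faceV x) with hle | hle
    · rw [max_eq_right hle] at h
      exact Or.inr ⟨by linarith, by linarith⟩
    · rw [max_eq_left hle] at h
      exact Or.inl ⟨by linarith, by linarith⟩
  · rintro (⟨h1, h2⟩ | ⟨h1, h2⟩)
    · rw [h1, neg_zero, max_eq_left (by linarith)]
    · rw [h1, neg_zero, max_eq_right (by linarith)]

/-- On `{r ≥ 0}` in the sector, `U ≤ |s|`. [folklore] -/
theorem faceU_le_abs_sFun {x : X} (hr : 0 ≤ B.rFun x) : D.faceU x ≤ |B.sFun x| := by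
  rw [faceU_eq]
  have h0 : 0 ≤ D.κ * (D.χ₁ (B.sFun x) * (D.χ₂ (B.rFun x) * B.rFun x)) :=
    mul_nonneg D.κ_pos.le (mul_nonneg D.χ₁.nonneg (mul_nonneg D.χ₂.nonneg hr))
  linarith [neg_le_abs (B.sFun x)]

/-- On `{r ≤ 0}`, `V ≤ |s|`. [folklore] -/
theorem faceV_le_abs_sFun {x : X} (hr : B.rFun x ≤ 0) : D.faceV x ≤ |B.sFun x| := by
  rw [faceV_eq]
  have h0 : D.κ * (D.χ₁ (B.sFun x) * (D.χ₂ (B.rFun x) * B.rFun x)) ≤ 0 :=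
    mul_nonpos_of_nonneg_of_nonpos D.κ_pos.le
      (mul_nonpos_of_nonneg_of_nonpos D.χ₁.nonneg (mul_nonpos_of_nonneg_of_nonpos D.χ₂.nonneg hr))
  linarith [neg_le_abs (B.sFun x)]

/-- `U ≤ |s| + κ rOut₂`. [folklore] -/
theorem faceU_le (x : X) : D.faceU x ≤ |B.sFun x| + D.κ * D.χ₂.rOut := by
  rw [faceU_eq]
  have h := D.bevel_term_le x
  have h1 : -(D.κ * (D.χ₁ (B.sFun x) * (D.χ₂ (B.rFun x) * B.rFun x))) ≤
      D.κ * (D.χ₁ (B.sFun x) * (D.χ₂ (B.rFun x) * |B.rFun x|)) := by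
    have : -B.rFun x ≤ |B.rFun x| := neg_le_abs _
    have h2 : 0 ≤ D.κ * (D.χ₁ (B.sFun x) * D.χ₂ (B.rFun x)) :=
      mul_nonneg D.κ_pos.le (mul_nonneg D.χ₁.nonneg D.χ₂.nonneg)
    nlinarith
  linarith [neg_le_abs (B.sFun x)]

/-- `V ≤ |s| + κ rOut₂`. [folklore] -/
theorem faceV_le (x : X) : D.faceV x ≤ |B.sFun x| + D.κ * D.χ₂.rOut := by
  rw [faceV_eq]
  have h := D.bevel_term_le x
  have h1 : D.κ * (D.χ₁ (B.sFun x) * (D.χ₂ (B.rFun x) * B.rFun x)) ≤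
      D.κ * (D.χ₁ (B.sFun x) * (D.χ₂ (B.rFun x) * |B.rFun x|)) := by
    have : B.rFun x ≤ |B.rFun x| := le_abs_self _
    have h2 : 0 ≤ D.κ * (D.χ₁ (B.sFun x) * D.χ₂ (B.rFun x)) :=
      mul_nonneg D.κ_pos.le (mul_nonneg D.χ₁.nonneg D.χ₂.nonneg)
    nlinarith
  linarith [neg_le_abs (B.sFun x)]

/-- **In the bi-collar box, `(U, V)` are the normal coordinates `(u, v)` of the corner charts of
`X₁`** (frame `u = -s - κ r`, `v = -s + κ r`). [cite: GayKirby2016, Def. 1 and Fig. 1] -/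
theorem faceU_eq_uFun_of_mem_box {x : X} (hx : x ∈ B.box D.εw) : D.faceU x = B.uFun D.frame x := by
  have hs : |B.sFun x| ≤ D.χ₁.rIn := (hx.1.trans_le (min_le_left _ _)).le
  have hr : |B.rFun x| ≤ D.χ₂.rIn := (hx.2.trans_le (min_le_right _ _)).le
  rw [faceU_eq, D.χ₁.one_of_abs_le hs, D.χ₂.one_of_abs_le hr]
  show _ = -1 * B.sFun x + -D.κ * B.rFun x
  ring

/-- In the bi-collar box, `V = v`. [cite: GayKirby2016, Def. 1 and Fig. 1] -/
theorem faceV_eq_vFun_of_mem_box {x : X} (hx : x ∈ B.box D.εw) : D.faceV x = B.vFun D.frame x := by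
  have hs : |B.sFun x| ≤ D.χ₁.rIn := (hx.1.trans_le (min_le_left _ _)).le
  have hr : |B.rFun x| ≤ D.χ₂.rIn := (hx.2.trans_le (min_le_right _ _)).le
  rw [faceV_eq, D.χ₁.one_of_abs_le hs, D.χ₂.one_of_abs_le hr]
  show _ = -1 * B.sFun x + D.κ * B.rFun x
  ring

/-- Below the collar (`rOut₁ ≤ |s|`), `U = V = -s`. [folklore] -/
theorem faceU_eq_neg_sFun_of_le {x : X} (h : D.χ₁.rOut ≤ |B.sFun x|) : D.faceU x = -B.sFun x := by
  rw [faceU_eq, D.χ₁.zero_of_le_abs h]; ring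

/-- Below the collar, `V = -s`. [folklore] -/
theorem faceV_eq_neg_sFun_of_le {x : X} (h : D.χ₁.rOut ≤ |B.sFun x|) : D.faceV x = -B.sFun x := by
  rw [faceV_eq, D.χ₁.zero_of_le_abs h]; ring

/-! ### The cut-offs `w₊`, `w₋` in `r` -/

/-- **`w₊ = cutDown εw (2εw) ∘ r`**: `1` for `r ≤ ε_w`, `0` for `r ≥ 2ε_w`. [folklore] -/
def wPlus (x : X) : ℝ := cutDown D.εw (2 * D.εw) (B.rFun x)

/-- **`w₋ = cutDown εw (2εw) ∘ (-r)`**: `1` for `-r ≤ ε_w`, `0` for `-r ≥ 2ε_w`. [folklore] -/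
def wMinus (x : X) : ℝ := cutDown D.εw (2 * D.εw) (-B.rFun x)

/-- `0 ≤ w₊ ≤ 1`. [folklore] -/
theorem wPlus_mem (x : X) : D.wPlus x ∈ Icc (0 : ℝ) 1 := ⟨cutDown_nonneg _, cutDown_le_one _⟩

/-- `0 ≤ w₋ ≤ 1`. [folklore] -/
theorem wMinus_mem (x : X) : D.wMinus x ∈ Icc (0 : ℝ) 1 := ⟨cutDown_nonneg _, cutDown_le_one _⟩

/-- `w₊ = 1` for `r ≤ ε_w`. [folklore] -/
theorem wPlus_of_le {x : X} (hx : B.rFun x ≤ D.εw) : D.wPlus x = 1 :=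
  cutDown_of_le (by linarith [D.εw_pos]) hx

/-- `w₋ = 1` for `-ε_w ≤ r`. [folklore] -/
theorem wMinus_of_le {x : X} (hx : -D.εw ≤ B.rFun x) : D.wMinus x = 1 :=
  cutDown_of_le (by linarith [D.εw_pos]) (by linarith)

/-- `w₊ = 0` for `2ε_w ≤ r`. [folklore] -/
theorem wPlus_of_ge {x : X} (hx : 2 * D.εw ≤ B.rFun x) : D.wPlus x = 0 :=
  cutDown_of_ge (by linarith [D.εw_pos]) hx

/-- `w₋ = 0` for `r ≤ -2ε_w`. [folklore] -/
theorem wMinus_of_ge {x : X} (hx : B.rFun x ≤ -(2 * D.εw)) : D.wMinus x = 0 :=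
  cutDown_of_ge (by linarith [D.εw_pos]) (by linarith)

/-- If `w₊ = 1` then `r ≤ ε_w` (the transition is strictly below `1` past `ε_w`). [folklore] -/
theorem rFun_le_of_wPlus_eq_one {x : X} (h : D.wPlus x = 1) : B.rFun x ≤ D.εw := by
  by_contra hlt
  have hlt' : D.εw < B.rFun x := not_le.1 hlt
  have harg : (2 * D.εw - B.rFun x) / (2 * D.εw - D.εw) < 1 := by
    rw [div_lt_one (by linarith [D.εw_pos])]; linarith
  have := smoothTransition.lt_one_of_lt_one harg
  exact absurd h (ne_of_lt this)

/-- If `w₋ = 1` then `-ε_w ≤ r`. [folklore] -/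
theorem le_rFun_of_wMinus_eq_one {x : X} (h : D.wMinus x = 1) : -D.εw ≤ B.rFun x := by
  by_contra hlt
  have hlt' : B.rFun x < -D.εw := not_le.1 hlt
  have harg : (2 * D.εw - -B.rFun x) / (2 * D.εw - D.εw) < 1 := by
    rw [div_lt_one (by linarith [D.εw_pos])]; linarith
  have := smoothTransition.lt_one_of_lt_one harg
  exact absurd h (ne_of_lt this)

/-- `w₊` is smooth on the band. [folklore] -/
theorem contMDiffOn_wPlus : ContMDiffOn (𝓡 4) 𝓘(ℝ, ℝ) ∞ D.wPlus B.U.band :=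
  contDiff_cutDown.contMDiff.comp_contMDiffOn B.contMDiffOn_rFun

/-- `w₋` is smooth on the band. [folklore] -/
theorem contMDiffOn_wMinus : ContMDiffOn (𝓡 4) 𝓘(ℝ, ℝ) ∞ D.wMinus B.U.band :=
  contDiff_cutDown.contMDiff.comp_contMDiffOn B.contMDiffOn_rFun.neg


/-! ### Along the unit-speed flow on the band: the face functions and the cut-offs -/

section FlowD

variable {x : X} (hx : |B.sFun x| < B.U.δ)

omit D [T2Space X] [CompactSpace X] in
/-- For `t` near `0`, `fl x t` stays in the band. [folklore] -/
theorem _root_.Literature.Topology.FourManifolds.BiCollar.eventually_add_mem_Ioo (B : BiCollar X) {x : X}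
    (hx : |B.sFun x| < B.U.δ) : ∀ᶠ t in 𝓝 (0 : ℝ), B.f x + t ∈ Ioo (B.a - B.U.δ) (B.a + B.U.δ) := by
  have hxU : x ∈ B.U.band := B.mem_band_U hx
  have hfx : B.f x ∈ Ioo (B.a - B.U.δ) (B.a + B.U.δ) := hxU
  have hopen : IsOpen ((fun t : ℝ => B.f x + t) ⁻¹' Ioo (B.a - B.U.δ) (B.a + B.U.δ)) :=
    isOpen_Ioo.preimage (continuous_const.add continuous_id)
  have h0 : (0 : ℝ) ∈ (fun t : ℝ => B.f x + t) ⁻¹' Ioo (B.a - B.U.δ) (B.a + B.U.δ) := by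
    show B.f x + 0 ∈ Ioo (B.a - B.U.δ) (B.a + B.U.δ); rw [add_zero]; exact hfx
  exact hopen.mem_nhds h0

include hx in
/-- **`U` along the flow**: `U (fl x t) = -(s + t) - κ χ₁(s + t) χ₂(r) r` for `t` near `0`. [folklore] -/
theorem faceU_fl_eventuallyEq : (fun t => D.faceU (B.U.fl x t)) =ᶠ[𝓝 0]
    fun t => -(B.sFun x + t) - D.κ * (D.χ₁ (B.sFun x + t) * (D.χ₂ (B.rFun x) * B.rFun x)) := by
  filter_upwards [B.eventually_add_mem_Ioo hx] with t ht
  rw [faceU, D.Ft_fl (B.mem_band_U hx) ht]; ring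

include hx in
/-- **`V` along the flow**: `V (fl x t) = -(s + t) + κ χ₁(s + t) χ₂(r) r` for `t` near `0`. [folklore] -/
theorem faceV_fl_eventuallyEq : (fun t => D.faceV (B.U.fl x t)) =ᶠ[𝓝 0]
    fun t => -(B.sFun x + t) + D.κ * (D.χ₁ (B.sFun x + t) * (D.χ₂ (B.rFun x) * B.rFun x)) := by
  filter_upwards [B.eventually_add_mem_Ioo hx] with t ht
  rw [faceV, D.Ft_fl (B.mem_band_U hx) ht]; ring

include hx in
/-- `w₊` is constant along the flow near `0`. [folklore] -/
theorem wPlus_fl_eventuallyEq : (fun t => D.wPlus (B.U.fl x t)) =ᶠ[𝓝 0] fun _ => D.wPlus x := by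
  filter_upwards [B.eventually_add_mem_Ioo hx] with t ht
  rw [wPlus, wPlus, B.rFun_fl_eq (B.mem_band_U hx) ht]

include hx in
/-- `w₋` is constant along the flow near `0`. [folklore] -/
theorem wMinus_fl_eventuallyEq : (fun t => D.wMinus (B.U.fl x t)) =ᶠ[𝓝 0] fun _ => D.wMinus x := by
  filter_upwards [B.eventually_add_mem_Ioo hx] with t ht
  rw [wMinus, wMinus, B.rFun_fl_eq (B.mem_band_U hx) ht]

omit D in
/-- `r` is constant along the flow near `0`. [folklore] -/
theorem _root_.Literature.Topology.FourManifolds.BiCollar.rFun_fl_eventuallyEq_band (B : BiCollar X) {x : X}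
    (hx : |B.sFun x| < B.U.δ) : (fun t => B.rFun (B.U.fl x t)) =ᶠ[𝓝 0] fun _ => B.rFun x := by
  filter_upwards [B.eventually_add_mem_Ioo hx] with t ht
  rw [B.rFun_fl_eq (B.mem_band_U hx) ht]

/-- The error term of the flow derivatives of the face functions. [folklore] -/
def err (x : X) : ℝ := D.κ * (deriv D.χ₁ (B.sFun x) * (D.χ₂ (B.rFun x) * B.rFun x))

omit [T2Space X] [CompactSpace X] in
/-- The bump `χ₁` is differentiable with derivative `deriv χ₁`. [folklore] -/
theorem hasDerivAt_χ₁ (s : ℝ) : HasDerivAt D.χ₁ (deriv D.χ₁ s) s :=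
  ((D.χ₁.contDiff.differentiable (by simp)).differentiableAt).hasDerivAt

include hx in
/-- **The flow derivative of `U` is `-1 - err`.** [folklore] -/
theorem hasDerivAt_faceU_fl : HasDerivAt (fun t => D.faceU (B.U.fl x t)) (-1 - D.err x) 0 := by
  refine HasDerivAt.congr_of_eventuallyEq ?_ (D.faceU_fl_eventuallyEq hx)
  set k : ℝ := D.χ₂ (B.rFun x) * B.rFun x with hk
  have h1 : HasDerivAt (fun t : ℝ => B.sFun x + t) 1 0 := (hasDerivAt_id (0 : ℝ)).const_add _
  have h2 : HasDerivAt (fun t : ℝ => D.χ₁ (B.sFun x + t)) (deriv D.χ₁ (B.sFun x)) 0 := by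
    have hχ : HasDerivAt (D.χ₁ : ℝ → ℝ) (deriv D.χ₁ (B.sFun x)) (B.sFun x + 0) := by
      rw [add_zero]; exact D.hasDerivAt_χ₁ _
    simpa using hχ.comp_const_add (B.sFun x) 0
  have h3 := (h1.neg).sub ((h2.mul_const k).const_mul D.κ)
  refine h3.congr_deriv ?_
  rw [err]

include hx in
/-- **The flow derivative of `V` is `-1 + err`.** [folklore] -/
theorem hasDerivAt_faceV_fl : HasDerivAt (fun t => D.faceV (B.U.fl x t)) (-1 + D.err x) 0 := by
  refine HasDerivAt.congr_of_eventuallyEq ?_ (D.faceV_fl_eventuallyEq hx)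
  set k : ℝ := D.χ₂ (B.rFun x) * B.rFun x with hk
  have h1 : HasDerivAt (fun t : ℝ => B.sFun x + t) 1 0 := (hasDerivAt_id (0 : ℝ)).const_add _
  have h2 : HasDerivAt (fun t : ℝ => D.χ₁ (B.sFun x + t)) (deriv D.χ₁ (B.sFun x)) 0 := by
    have hχ : HasDerivAt (D.χ₁ : ℝ → ℝ) (deriv D.χ₁ (B.sFun x)) (B.sFun x + 0) := by
      rw [add_zero]; exact D.hasDerivAt_χ₁ _
    simpa using hχ.comp_const_add (B.sFun x) 0
  have h3 := (h1.neg).add ((h2.mul_const k).const_mul D.κ)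
  refine h3.congr_deriv ?_
  rw [err]


end FlowD

/-! ### Parameters of the construction -/

/-- **Parameters of the adapted function on `X₁`**: the plateau height `c` and smoothing width
`ε'` of `m(s) = plateauAbs c ε' s` — the plateau `{|s| ≤ c - ε'}` covers the bi-collar box
(`εw_le`), `c ≥ κ rOut₂ + ε'` (`κ_le`, so that `V ≤ 2m`), and `m = |s|` from `|s| = c + ε' ≤
rOut₁` on (`c_le`, so that the formula is `1 + s` below the collar) — and a bound `L` of the
slope of the bump `χ₁` against which the bevel slope `κ` is small (`hκ`). [folklore] -/
structure SectorOneParams where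
  /-- Plateau height. -/
  c : ℝ
  /-- Smoothing width. -/
  ε' : ℝ
  /-- A bound for `|χ₁'|`. -/
  L : ℝ
  /-- The width is positive. -/
  ε'_pos : 0 < ε'
  /-- The plateau covers the box. -/
  εw_le : D.εw + ε' ≤ c
  /-- The plateau height dominates the bevel term. -/
  κ_le : D.κ * D.χ₂.rOut + ε' ≤ c
  /-- The smoothing is `|s|` below the collar. -/
  c_le : c + ε' ≤ D.χ₁.rOut
  /-- `L` bounds the slope of `χ₁`. -/
  abs_deriv_le : ∀ s, |deriv D.χ₁ s| ≤ L
  /-- **Smallness of the bevel slope**: `κ L rOut₂ ≤ 1/4`. -/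
  hκ : D.κ * L * D.χ₂.rOut ≤ 1 / 4

/-- The slope of a bump is bounded. [folklore] -/
theorem _root_.Literature.Topology.FourManifolds.Bump.exists_abs_deriv_le (χ : Bump) :
    ∃ L, 0 ≤ L ∧ ∀ s, |deriv χ s| ≤ L := by
  have hcont : Continuous (deriv χ) := (χ.contDiff.continuous_deriv (by simp))
  obtain ⟨L, hL⟩ := (isCompact_Icc (a := -χ.rOut) (b := χ.rOut)).exists_bound_of_continuousOn
    hcont.continuousOn
  have hout : ∀ s, χ.rOut < |s| → deriv χ s = 0 := fun s hs => by
    have hev : (χ : ℝ → ℝ) =ᶠ[𝓝 s] fun _ => 0 := by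
      have hopen : IsOpen {t : ℝ | χ.rOut < |t|} := isOpen_lt continuous_const continuous_abs
      filter_upwards [hopen.mem_nhds hs] with t ht
      exact χ.zero_of_le_abs ht.le
    rw [hev.deriv_eq, deriv_const]
  refine ⟨max L 0, le_max_right _ _, fun s => ?_⟩
  by_cases hs : χ.rOut < |s|
  · rw [hout s hs, abs_zero]; exact le_max_right _ _
  · have hmem : s ∈ Icc (-χ.rOut) χ.rOut := by
      rw [mem_Icc, ← abs_le]; exact not_lt.1 hs
    exact ((hL s hmem).trans (le_max_left _ _) : ‖deriv χ s‖ ≤ max L 0)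

omit [T2Space X] [CompactSpace X] in
/-- **Parameters exist as soon as the bevel slope is small against the slope of `χ₁`.** [folklore] -/
theorem nonempty_sectorOneParams {L : ℝ} (hL : ∀ s, |deriv D.χ₁ s| ≤ L) (hκ : D.κ * L * D.χ₂.rOut ≤ 1 / 4) :
    Nonempty D.SectorOneParams := by
  have h1 : D.εw < D.χ₁.rOut := (min_le_left _ _).trans_lt D.χ₁.rIn_lt_rOut
  have h2 : D.κ * D.χ₂.rOut < D.χ₁.rOut := D.κ_mul_rOut₂_lt.trans D.χ₁.rIn_lt_rOut
  set M := max D.εw (D.κ * D.χ₂.rOut) with hM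
  have hM1 : M < D.χ₁.rOut := max_lt h1 h2
  refine ⟨⟨M + (D.χ₁.rOut - M) / 3, (D.χ₁.rOut - M) / 3, L, by linarith, ?_, ?_, by linarith, hL, hκ⟩⟩
  · linarith [le_max_left D.εw (D.κ * D.χ₂.rOut)]
  · linarith [le_max_right D.εw (D.κ * D.χ₂.rOut)]

namespace SectorOneParams

variable {D} (P : D.SectorOneParams)

omit [T2Space X] [CompactSpace X] in
/-- `ε' ≤ c`. [folklore] -/
theorem ε'_le_c : P.ε' ≤ P.c := by linarith [P.εw_le, D.εw_pos]

omit [T2Space X] [CompactSpace X] in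
/-- `0 < c`. [folklore] -/
theorem c_pos : 0 < P.c := P.ε'_pos.trans_le P.ε'_le_c

omit [T2Space X] [CompactSpace X] in
/-- `0 ≤ L`. [folklore] -/
theorem L_nonneg : 0 ≤ P.L := (abs_nonneg _).trans (P.abs_deriv_le 0)

omit [T2Space X] [CompactSpace X] in
include P in
/-- The error `e = κ χ₁'(s) χ₂(r) r` of the flow derivative of the face functions is at most
`1/4` in absolute value. [folklore] -/
theorem abs_err_le (s r : ℝ) : |D.κ * (deriv D.χ₁ s * (D.χ₂ r * r))| ≤ 1 / 4 := by
  have h1 : |D.χ₂ r * r| ≤ D.χ₂.rOut := by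
    rw [abs_mul, abs_of_nonneg D.χ₂.nonneg]; exact D.χ₂_mul_abs_le r
  have h2 := P.abs_deriv_le s
  rw [abs_mul, abs_mul, abs_of_pos D.κ_pos]
  calc D.κ * (|deriv D.χ₁ s| * |D.χ₂ r * r|) ≤ D.κ * (P.L * D.χ₂.rOut) := by
        apply mul_le_mul_of_nonneg_left _ D.κ_pos.le
        exact mul_le_mul h2 h1 (abs_nonneg _) P.L_nonneg
    _ ≤ 1 / 4 := by rw [← mul_assoc]; exact P.hκ

/-! ### The auxiliary functions `m`, `w₊`, `w₋` and the function -/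

/-- **`m = plateauAbs c ε' ∘ s`.** [folklore] -/
def mFun (x : X) : ℝ := plateauAbs P.c P.ε' (B.sFun x)

/-- **The formula on the band**:
`1 - (U V (w₊ + w₋ - 1) + (1 - w₊) U m + (1 - w₋) V m) / m`. [cite: GayKirby2016, §4, Lemma 14] -/
def bandFormula (x : X) : ℝ :=
  1 - (D.faceU x * D.faceV x * (D.wPlus x + D.wMinus x - 1) + (1 - D.wPlus x) * D.faceU x * P.mFun x +
    (1 - D.wMinus x) * D.faceV x * P.mFun x) / P.mFun x

open Classical in
/-- **The adapted function on `X₁`**: the band formula on the band `|s| < δ_U`, `1 + s` below.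
[cite: GayKirby2016, §4, Lemma 14] -/
def secFun (x : X) : ℝ := if |B.sFun x| < B.U.δ then P.bandFormula x else 1 + B.sFun x

omit [T2Space X] [CompactSpace X] in
/-- `m > 0`. [folklore] -/
theorem mFun_pos (x : X) : 0 < P.mFun x := plateauAbs_pos P.ε'_pos P.ε'_le_c _

omit [T2Space X] [CompactSpace X] in
/-- `|s| ≤ m`. [folklore] -/
theorem abs_sFun_le_mFun (x : X) : |B.sFun x| ≤ P.mFun x := abs_le_plateauAbs P.ε'_pos P.ε'_le_c _

omit [T2Space X] [CompactSpace X] in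
/-- `c ≤ m`. [folklore] -/
theorem c_le_mFun (x : X) : P.c ≤ P.mFun x := le_plateauAbs P.ε'_pos P.ε'_le_c _

omit [T2Space X] [CompactSpace X] in
/-- **On the box, `m = c`.** [folklore] -/
theorem mFun_of_abs_lt {x : X} (hx : |B.sFun x| < D.εw) : P.mFun x = P.c :=
  plateauAbs_of_abs_le P.ε'_pos P.ε'_le_c (by linarith [P.εw_le])

omit [T2Space X] [CompactSpace X] in
/-- **Below the collar, `m = |s|`.** [folklore] -/
theorem mFun_of_le {x : X} (hx : D.χ₁.rOut ≤ |B.sFun x|) : P.mFun x = |B.sFun x| :=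
  plateauAbs_of_le_abs P.ε'_pos P.ε'_le_c (P.c_le.trans hx)

/-! ### The formula in the three regimes -/

/-- **The coefficient on `{r ≥ 0}`**: `Λ₊ = (V w₊ + (1 - w₊) m) / m`. [folklore] -/
def LamPlus (x : X) : ℝ := (D.faceV x * D.wPlus x + (1 - D.wPlus x) * P.mFun x) / P.mFun x

/-- **The coefficient on `{r ≤ 0}`**: `Λ₋ = (U w₋ + (1 - w₋) m) / m`. [folklore] -/
def LamMinus (x : X) : ℝ := (D.faceU x * D.wMinus x + (1 - D.wMinus x) * P.mFun x) / P.mFun x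

/-- **On `{r ≥ 0}` the band formula is `1 - U Λ₊`.** [folklore] -/
theorem bandFormula_of_rFun_nonneg {x : X} (hr : 0 ≤ B.rFun x) : P.bandFormula x = 1 - D.faceU x * P.LamPlus x := by
  have hm := (P.mFun_pos x).ne'
  rw [bandFormula, LamPlus, D.wMinus_of_le (by linarith [D.εw_pos])]
  field_simp
  ring

/-- **On `{r ≤ 0}` the band formula is `1 - V Λ₋`.** [folklore] -/
theorem bandFormula_of_rFun_nonpos {x : X} (hr : B.rFun x ≤ 0) : P.bandFormula x = 1 - D.faceV x * P.LamMinus x := by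
  have hm := (P.mFun_pos x).ne'
  rw [bandFormula, LamMinus, D.wPlus_of_le (by linarith [D.εw_pos])]
  field_simp
  ring

/-- **On the box the band formula is the corner form `1 - u v / c`.** [cite: GayKirby2016, Def. 1 and Fig. 1] -/
theorem bandFormula_of_mem_box {x : X} (hx : x ∈ B.box D.εw) :
    P.bandFormula x = 1 - B.uFun D.frame x * B.vFun D.frame x / P.c := by
  have hr : |B.rFun x| < D.εw := hx.2
  rw [bandFormula, D.wPlus_of_le (abs_lt.1 hr).2.le, D.wMinus_of_le (abs_lt.1 hr).1.le, P.mFun_of_abs_lt hx.1,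
    D.faceU_eq_uFun_of_mem_box hx, D.faceV_eq_vFun_of_mem_box hx]
  ring

/-- **Below the collar the band formula is `1 + s`** (`U = V = -s = |s| = m`). [folklore] -/
theorem bandFormula_of_rOut_le {x : X} (h : D.χ₁.rOut ≤ |B.sFun x|) (hs : B.sFun x < 0) :
    P.bandFormula x = 1 + B.sFun x := by
  rw [bandFormula, D.faceU_eq_neg_sFun_of_le h, D.faceV_eq_neg_sFun_of_le h, P.mFun_of_le h, abs_of_neg hs]
  have hs' : B.sFun x ≠ 0 := hs.ne
  field_simp
  ring

/-- On the band, `secFun` is the band formula. [folklore] -/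
theorem secFun_of_abs_lt {x : X} (hx : |B.sFun x| < B.U.δ) : P.secFun x = P.bandFormula x := by
  classical
  exact if_pos hx

/-- Off the band, `secFun = 1 + s`. [folklore] -/
theorem secFun_of_le_abs {x : X} (hx : B.U.δ ≤ |B.sFun x|) : P.secFun x = 1 + B.sFun x := by
  classical
  exact if_neg (not_lt.2 hx)

/-- **Below the collar, `secFun = 1 + s`** (whether on the band or not). [folklore] -/
theorem secFun_of_sFun_lt {x : X} (hx : B.sFun x < -D.χ₁.rOut) : P.secFun x = 1 + B.sFun x := by
  by_cases hb : |B.sFun x| < B.U.δ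
  · rw [P.secFun_of_abs_lt hb]
    have hs : B.sFun x < 0 := by linarith [D.χ₁.rOut_pos]
    exact P.bandFormula_of_rOut_le (by rw [abs_of_neg hs]; linarith) hs
  · exact P.secFun_of_le_abs (not_lt.1 hb)

/-- **On the box, `secFun` is the corner form `1 - u v / c`.** [cite: GayKirby2016, Def. 1 and Fig. 1] -/
theorem secFun_of_mem_box {x : X} (hx : x ∈ B.box D.εw) :
    P.secFun x = 1 - B.uFun D.frame x * B.vFun D.frame x / P.c := by
  rw [P.secFun_of_abs_lt (hx.1.trans_le D.εw_le_δU), P.bandFormula_of_mem_box hx]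

/-! ### Smoothness -/

omit [T2Space X] [CompactSpace X] in
/-- `m` is smooth. [folklore] -/
theorem contMDiff_mFun : ContMDiff (𝓡 4) 𝓘(ℝ, ℝ) ∞ P.mFun :=
  (contDiff_plateauAbs).contMDiff.comp B.contMDiff_sFun

/-- **The band formula is smooth on the band.** [folklore] -/
theorem contMDiffOn_bandFormula : ContMDiffOn (𝓡 4) 𝓘(ℝ, ℝ) ∞ P.bandFormula B.U.band := by
  have hU := D.contMDiff_faceU.contMDiffOn (s := B.U.band)
  have hV := D.contMDiff_faceV.contMDiffOn (s := B.U.band)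
  have hm := P.contMDiff_mFun.contMDiffOn (s := B.U.band)
  have hp := D.contMDiffOn_wPlus
  have hn := D.contMDiffOn_wMinus
  refine contMDiffOn_const.sub (ContMDiffOn.div₀ ?_ hm fun x _ => (P.mFun_pos x).ne')
  exact ((hU.mul hV).mul ((hp.add hn).sub contMDiffOn_const)).add
    (((contMDiffOn_const.sub hp).mul hU).mul hm) |>.add (((contMDiffOn_const.sub hn).mul hV).mul hm)

/-- **`secFun` is smooth at every point of the band.** [folklore] -/
theorem contMDiffAt_secFun_of_abs_lt {x : X} (hx : |B.sFun x| < B.U.δ) :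
    ContMDiffAt (𝓡 4) 𝓘(ℝ, ℝ) ∞ P.secFun x := by
  have hxb : x ∈ B.U.band := B.mem_band_U hx
  have hev : P.secFun =ᶠ[𝓝 x] P.bandFormula := by
    filter_upwards [B.U.isOpen_band.mem_nhds hxb] with y hy
    exact P.secFun_of_abs_lt ((B.abs_sFun_lt_iff y).2 hy)
  exact ((P.contMDiffOn_bandFormula).contMDiffAt (B.U.isOpen_band.mem_nhds hxb)).congr_of_eventuallyEq hev

/-- **`secFun` is `1 + s` near every point below the collar.** [folklore] -/
theorem secFun_eventuallyEq_of_sFun_lt {x : X} (hx : B.sFun x < -D.χ₁.rOut) :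
    P.secFun =ᶠ[𝓝 x] fun y => 1 + B.sFun y := by
  have hopen : IsOpen {y : X | B.sFun y < -D.χ₁.rOut} := isOpen_lt B.contMDiff_sFun.continuous continuous_const
  filter_upwards [hopen.mem_nhds hx] with y hy
  exact P.secFun_of_sFun_lt hy

/-- **`secFun` is smooth at every point below the collar.** [folklore] -/
theorem contMDiffAt_secFun_of_sFun_lt {x : X} (hx : B.sFun x < -D.χ₁.rOut) :
    ContMDiffAt (𝓡 4) 𝓘(ℝ, ℝ) ∞ P.secFun x :=
  (contMDiffAt_const.add B.contMDiff_sFun.contMDiffAt).congr_of_eventuallyEq (P.secFun_eventuallyEq_of_sFun_lt hx)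

/-- **`secFun` is smooth at every point of the sector** (such points have `s ≤ 0`, hence lie on
the band or below the collar). [folklore] -/
theorem contMDiffAt_secFun {x : X} (hx : x ∈ D.sector) : ContMDiffAt (𝓡 4) 𝓘(ℝ, ℝ) ∞ P.secFun x := by
  by_cases hb : |B.sFun x| < B.U.δ
  · exact P.contMDiffAt_secFun_of_abs_lt hb
  · have hs0 : B.sFun x ≤ 0 := D.sFun_nonpos_of_mem_sector hx
    have hs : B.sFun x ≤ -B.U.δ := by
      have := not_lt.1 hb; rw [abs_of_nonpos hs0] at this; linarith
    exact P.contMDiffAt_secFun_of_sFun_lt (by linarith [D.rOut₁_lt])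

/-! ### Values: `1` on the boundary, `< 1` inside -/

/-- **`Λ₊ > 0` at points of the sector off the surface with `r ≥ 0`.** [folklore] -/
theorem LamPlus_pos {x : X} (hx : x ∈ D.sector) (hxs : x ∉ B.surface) (hr : 0 ≤ B.rFun x) : 0 < P.LamPlus x := by
  have hm := P.mFun_pos x
  have hV : 0 ≤ D.faceV x := ((D.mem_sector_iff_face x).1 hx).2
  have hU : 0 ≤ D.faceU x := ((D.mem_sector_iff_face x).1 hx).1
  obtain ⟨hw0, hw1⟩ := D.wPlus_mem x
  rw [LamPlus]
  apply div_pos _ hm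
  -- `V w + (1 - w) m ≥ 0`, and `= 0` forces `w = 1`, `V = 0`, whence `x ∈ F`
  rcases hw1.lt_or_eq with hlt | heq
  · have : 0 < (1 - D.wPlus x) * P.mFun x := mul_pos (by linarith) hm
    nlinarith
  · rw [heq, mul_one, sub_self, zero_mul, add_zero]
    rcases hV.lt_or_eq with hVpos | hV0
    · exact hVpos
    · exfalso
      apply hxs
      -- `w₊ = 1` gives `r ≤ ε_w`, so `χ₂ (r) = 1`; `V = 0 ≤ U` with `U + V = -2s`, `V - U = 2κχ₁(s) r`
      have hrle : B.rFun x ≤ D.εw := D.rFun_le_of_wPlus_eq_one heq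
      have hχ₂ : D.χ₂ (B.rFun x) = 1 := D.χ₂.one_of_abs_le (by
        rw [abs_of_nonneg hr]; exact hrle.trans (min_le_right _ _))
      have hVe := D.faceV_eq x
      have hUe := D.faceU_eq x
      rw [hχ₂, one_mul] at hVe hUe
      have hκ := D.κ_pos
      have hχ₁ := D.χ₁.nonneg (x := B.sFun x)
      -- from `V = 0`: `s = κ χ₁(s) r ≥ 0`; from `U ≥ 0`: `-s ≥ κ χ₁(s) r ≥ 0`; so `s = 0` and `κ χ₁(0) r = 0`
      have h1 : B.sFun x = D.κ * (D.χ₁ (B.sFun x) * B.rFun x) := by linarith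
      have h2 : 0 ≤ D.κ * (D.χ₁ (B.sFun x) * B.rFun x) := mul_nonneg hκ.le (mul_nonneg hχ₁ hr)
      have hs0 : B.sFun x = 0 := by linarith
      have h3 : D.χ₁ (B.sFun x) = 1 := D.χ₁.one_of_abs_le (by rw [hs0, abs_zero]; exact D.χ₁.rIn_pos.le)
      rw [h3, one_mul] at h1
      have hr0 : B.rFun x = 0 := by
        have : D.κ * B.rFun x = 0 := by linarith
        exact (mul_eq_zero.1 this).resolve_left hκ.ne'
      exact (B.mem_surface_iff x).2 ⟨hs0, hr0⟩

/-- **`Λ₋ > 0` at points of the sector off the surface with `r ≤ 0`.** [folklore] -/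
theorem LamMinus_pos {x : X} (hx : x ∈ D.sector) (hxs : x ∉ B.surface) (hr : B.rFun x ≤ 0) : 0 < P.LamMinus x := by
  have hm := P.mFun_pos x
  have hV : 0 ≤ D.faceV x := ((D.mem_sector_iff_face x).1 hx).2
  have hU : 0 ≤ D.faceU x := ((D.mem_sector_iff_face x).1 hx).1
  obtain ⟨hw0, hw1⟩ := D.wMinus_mem x
  rw [LamMinus]
  apply div_pos _ hm
  rcases hw1.lt_or_eq with hlt | heq
  · have : 0 < (1 - D.wMinus x) * P.mFun x := mul_pos (by linarith) hm
    nlinarith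
  · rw [heq, mul_one, sub_self, zero_mul, add_zero]
    rcases hU.lt_or_eq with hUpos | hU0
    · exact hUpos
    · exfalso
      apply hxs
      have hrle : -D.εw ≤ B.rFun x := D.le_rFun_of_wMinus_eq_one heq
      have hχ₂ : D.χ₂ (B.rFun x) = 1 := D.χ₂.one_of_abs_le (by
        rw [abs_of_nonpos hr]; exact (neg_le.1 hrle).trans (min_le_right _ _) |> fun h => by linarith [min_le_right D.χ₁.rIn D.χ₂.rIn, h])
      have hVe := D.faceV_eq x
      have hUe := D.faceU_eq x
      rw [hχ₂, one_mul] at hVe hUe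
      have hκ := D.κ_pos
      have hχ₁ := D.χ₁.nonneg (x := B.sFun x)
      have h1 : -B.sFun x = D.κ * (D.χ₁ (B.sFun x) * B.rFun x) := by linarith
      have h2 : D.κ * (D.χ₁ (B.sFun x) * B.rFun x) ≤ 0 :=
        mul_nonpos_of_nonneg_of_nonpos hκ.le (mul_nonpos_of_nonneg_of_nonpos hχ₁ hr)
      have hs0 : B.sFun x = 0 := by linarith
      have h3 : D.χ₁ (B.sFun x) = 1 := D.χ₁.one_of_abs_le (by rw [hs0, abs_zero]; exact D.χ₁.rIn_pos.le)
      rw [h3, one_mul] at h1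
      have hr0 : B.rFun x = 0 := by
        have : D.κ * B.rFun x = 0 := by linarith
        exact (mul_eq_zero.1 this).resolve_left hκ.ne'
      exact (B.mem_surface_iff x).2 ⟨hs0, hr0⟩

/-- **`secFun = 1` on `∂X₁`** (`F₁ = 0`). [cite: GayKirby2016, §4, Lemma 14] -/
theorem secFun_eq_one_of_F₁_eq_zero {x : X} (h0 : D.F₁ x = 0) : P.secFun x = 1 := by
  have hs : |B.sFun x| < B.U.δ := (D.abs_sFun_lt_rIn_of_F₁_eq_zero h0).trans D.rIn₁_lt
  rw [P.secFun_of_abs_lt hs]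
  rcases le_total 0 (B.rFun x) with hr | hr
  · rw [P.bandFormula_of_rFun_nonneg hr, show D.faceU x = 0 by have := D.F₁_eq_neg_faceU hr; linarith]; ring
  · rw [P.bandFormula_of_rFun_nonpos hr, show D.faceV x = 0 by have := D.F₁_eq_neg_faceV hr; linarith]; ring

/-- **`secFun < 1` inside `X₁`** (`F₁ < 0`). [cite: GayKirby2016, §4, Lemma 14] -/
theorem secFun_lt_one_of_F₁_neg {x : X} (h0 : D.F₁ x < 0) : P.secFun x < 1 := by
  have hx : x ∈ D.sector := D.mem_sector_iff.2 h0.le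
  have hxs : x ∉ B.surface := fun h => h0.ne (D.F₁_eq_zero_of_mem_surface h)
  obtain ⟨hU, hV⟩ := (D.F₁_neg_iff_face x).1 h0
  by_cases hb : |B.sFun x| < B.U.δ
  · rw [P.secFun_of_abs_lt hb]
    rcases le_total 0 (B.rFun x) with hr | hr
    · rw [P.bandFormula_of_rFun_nonneg hr]
      have := P.LamPlus_pos hx hxs hr
      nlinarith
    · rw [P.bandFormula_of_rFun_nonpos hr]
      have := P.LamMinus_pos hx hxs hr
      nlinarith
  · rw [P.secFun_of_le_abs (not_lt.1 hb)]
    have hs0 : B.sFun x ≤ 0 := D.sFun_nonpos_of_mem_sector hx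
    have := not_lt.1 hb
    rw [abs_of_nonpos hs0] at this
    linarith [B.U.δ_pos]

/-! ### Two real inequalities -/

omit [T2Space X] [CompactSpace X] in
/-- The key inequality `(3/4)(U + V) m - U V > 0` for `0 ≤ U ≤ m`, `0 ≤ V ≤ 2m`, `U + V > 0`. [folklore] -/
theorem key_ineq {U V m : ℝ} (hU0 : 0 ≤ U) (hV0 : 0 ≤ V) (hUV : 0 < U + V) (hm : 0 < m) (hUm : U ≤ m)
    (hVm : V ≤ 2 * m) : 0 < 3 / 4 * (U + V) * m - U * V := by
  have hm0 : 0 ≤ m := hm.le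
  by_cases hU : U ≤ 3 / 4 * m
  · -- both `(3/4) U m` and `V ((3/4) m - U)` are nonnegative, one is positive
    have h1 : 0 ≤ V * (3 / 4 * m - U) := mul_nonneg hV0 (by linarith)
    rcases hV0.lt_or_eq with hVpos | hV00
    · rcases hU0.lt_or_eq with hUpos | hU00
      · nlinarith
      · rw [← hU00]; nlinarith
    · rw [← hV00] at hUV ⊢; nlinarith
  · have hU' : 3 / 4 * m < U := not_le.1 hU
    nlinarith

omit [T2Space X] [CompactSpace X] in
/-- **Positivity of the flow derivative of the band formula** (written for `{r ≥ 0}`; the case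
`{r ≤ 0}` is the same with `U`, `V` exchanged): with `Λ = (V w + (1 - w) m)/m`,
`-U' Λ - U Λ' > 0`. [folklore] -/
theorem flowDeriv_pos {U V m dU dV dm w : ℝ} (hU0 : 0 ≤ U) (hV0 : 0 ≤ V) (hUV : 0 < U + V) (hm : 0 < m)
    (hUm : U ≤ m) (hVm : V ≤ 2 * m) (hdU : dU ≤ -(3 / 4)) (hdV : dV ≤ -(3 / 4)) (hdm1 : -1 ≤ dm)
    (hw0 : 0 ≤ w) (hw1 : w ≤ 1) :
    0 < -dU * ((V * w + (1 - w) * m) / m) -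
      U * (((dV * w + (1 - w) * dm) * m - (V * w + (1 - w) * m) * dm) / m ^ 2) := by
  have hm2 : 0 < m ^ 2 := by positivity
  have hkey := key_ineq hU0 hV0 hUV hm hUm hVm
  have hmne : m ≠ 0 := hm.ne'
  -- clear denominators
  have hexp : -dU * ((V * w + (1 - w) * m) / m) -
      U * (((dV * w + (1 - w) * dm) * m - (V * w + (1 - w) * m) * dm) / m ^ 2) =
      (-dU * (V * w + (1 - w) * m) * m - U * w * dV * m + U * w * V * dm) / m ^ 2 := by
    field_simp
    ring
  rw [hexp]
  apply div_pos _ hm2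
  have h1 : 3 / 4 * ((V * w + (1 - w) * m) * m) ≤ -dU * (V * w + (1 - w) * m) * m := by
    have : 0 ≤ (V * w + (1 - w) * m) * m := by
      have : 0 ≤ V * w + (1 - w) * m := by nlinarith
      nlinarith
    nlinarith
  have h2 : 3 / 4 * (U * w * m) ≤ -(U * w * dV * m) := by
    have : 0 ≤ U * w * m := by positivity
    nlinarith
  have h3 : -(U * w * V) ≤ U * w * V * dm := by
    have : 0 ≤ U * w * V := by positivity
    nlinarith
  -- `(3/4)(1 - w) m² + w [(3/4)(U + V) m - U V] > 0`
  rcases hw1.lt_or_eq with hwlt | hweq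
  · have : 0 < 3 / 4 * (1 - w) * m ^ 2 := by
      have : 0 < 1 - w := by linarith
      positivity
    nlinarith
  · subst hweq
    nlinarith

/-! ### Along the unit-speed flow on the band -/

section Flow

variable {x : X} (hx : |B.sFun x| < B.U.δ)

include P in
/-- `|err| ≤ 1/4`. [folklore] -/
theorem abs_err_le' (x : X) : |D.err x| ≤ 1 / 4 := P.abs_err_le _ _


include hx in
/-- `m` along the flow: `m (fl x t) = plateauAbs c ε' (s + t)` for `t` near `0`. [folklore] -/
theorem mFun_fl_eventuallyEq : (fun t => P.mFun (B.U.fl x t)) =ᶠ[𝓝 0] fun t => plateauAbs P.c P.ε' (B.sFun x + t) := by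
  filter_upwards [B.eventually_add_mem_Ioo hx] with t ht
  rw [mFun, B.sFun_fl_eq (B.mem_band_U hx) ht]

include hx in
/-- **The flow derivative of `m` is `m'(s)`.** [folklore] -/
theorem hasDerivAt_mFun_fl : HasDerivAt (fun t => P.mFun (B.U.fl x t)) (deriv (plateauAbs P.c P.ε') (B.sFun x)) 0 := by
  refine HasDerivAt.congr_of_eventuallyEq ?_ (P.mFun_fl_eventuallyEq hx)
  have h : HasDerivAt (plateauAbs P.c P.ε') (deriv (plateauAbs P.c P.ε') (B.sFun x)) (B.sFun x + 0) := by
    rw [add_zero]; exact (hasDerivAt_plateauAbs P.ε'_pos _).differentiableAt.hasDerivAt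
  simpa using h.comp_const_add (B.sFun x) 0

include hx in
/-- **The flow derivative of `Λ₊`.** [folklore] -/
theorem hasDerivAt_LamPlus_fl :
    HasDerivAt (fun t => P.LamPlus (B.U.fl x t))
      ((((-1 + D.err x) * D.wPlus x + (1 - D.wPlus x) * deriv (plateauAbs P.c P.ε') (B.sFun x)) * P.mFun x -
        (D.faceV x * D.wPlus x + (1 - D.wPlus x) * P.mFun x) * deriv (plateauAbs P.c P.ε') (B.sFun x)) /
        P.mFun x ^ 2) 0 := by
  have hev : (fun t => P.LamPlus (B.U.fl x t)) =ᶠ[𝓝 0]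
      fun t => (D.faceV (B.U.fl x t) * D.wPlus x + (1 - D.wPlus x) * P.mFun (B.U.fl x t)) / P.mFun (B.U.fl x t) := by
    filter_upwards [D.wPlus_fl_eventuallyEq hx] with t ht
    rw [LamPlus, ht]
  refine HasDerivAt.congr_of_eventuallyEq ?_ hev
  have hV := D.hasDerivAt_faceV_fl hx
  have hm := P.hasDerivAt_mFun_fl hx
  have hnum := (hV.mul_const (D.wPlus x)).add (hm.const_mul (1 - D.wPlus x))
  have h := hnum.div hm (by rw [B.U.fl_zero]; exact (P.mFun_pos x).ne')
  refine (h.congr_of_eventuallyEq (Eventually.of_forall fun t => rfl)).congr_deriv ?_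
  simp only [Pi.add_apply, B.U.fl_zero]

include hx in
/-- **The flow derivative of `Λ₋`.** [folklore] -/
theorem hasDerivAt_LamMinus_fl :
    HasDerivAt (fun t => P.LamMinus (B.U.fl x t))
      ((((-1 - D.err x) * D.wMinus x + (1 - D.wMinus x) * deriv (plateauAbs P.c P.ε') (B.sFun x)) * P.mFun x -
        (D.faceU x * D.wMinus x + (1 - D.wMinus x) * P.mFun x) * deriv (plateauAbs P.c P.ε') (B.sFun x)) /
        P.mFun x ^ 2) 0 := by
  have hev : (fun t => P.LamMinus (B.U.fl x t)) =ᶠ[𝓝 0]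
      fun t => (D.faceU (B.U.fl x t) * D.wMinus x + (1 - D.wMinus x) * P.mFun (B.U.fl x t)) / P.mFun (B.U.fl x t) := by
    filter_upwards [D.wMinus_fl_eventuallyEq hx] with t ht
    rw [LamMinus, ht]
  refine HasDerivAt.congr_of_eventuallyEq ?_ hev
  have hU := D.hasDerivAt_faceU_fl hx
  have hm := P.hasDerivAt_mFun_fl hx
  have hnum := (hU.mul_const (D.wMinus x)).add (hm.const_mul (1 - D.wMinus x))
  have h := hnum.div hm (by rw [B.U.fl_zero]; exact (P.mFun_pos x).ne')
  refine (h.congr_of_eventuallyEq (Eventually.of_forall fun t => rfl)).congr_deriv ?_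
  simp only [Pi.add_apply, B.U.fl_zero]

include hx in
/-- **The flow derivative of `secFun` on `{r ≥ 0}`**: `-U' Λ₊ - U Λ₊'`. [folklore] -/
theorem hasDerivAt_secFun_fl_of_rFun_nonneg (hr : 0 ≤ B.rFun x) :
    HasDerivAt (fun t => P.secFun (B.U.fl x t))
      (-(-1 - D.err x) * P.LamPlus x - D.faceU x *
        ((((-1 + D.err x) * D.wPlus x + (1 - D.wPlus x) * deriv (plateauAbs P.c P.ε') (B.sFun x)) * P.mFun x -
          (D.faceV x * D.wPlus x + (1 - D.wPlus x) * P.mFun x) * deriv (plateauAbs P.c P.ε') (B.sFun x)) /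
          P.mFun x ^ 2)) 0 := by
  have hev : (fun t => P.secFun (B.U.fl x t)) =ᶠ[𝓝 0] fun t => 1 - D.faceU (B.U.fl x t) * P.LamPlus (B.U.fl x t) := by
    filter_upwards [B.eventually_add_mem_Ioo hx, B.rFun_fl_eventuallyEq_band hx] with t ht hrt
    have hband : |B.sFun (B.U.fl x t)| < B.U.δ := by
      rw [B.sFun_fl_eq (B.mem_band_U hx) ht]
      have h1 := ht.1; have h2 := ht.2
      rw [B.f_eq_add_sFun] at h1 h2
      rw [abs_lt]; constructor <;> linarith
    rw [P.secFun_of_abs_lt hband, P.bandFormula_of_rFun_nonneg (by rw [hrt]; exact hr)]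
  refine HasDerivAt.congr_of_eventuallyEq ?_ hev
  have hU := D.hasDerivAt_faceU_fl hx
  have hΛ := P.hasDerivAt_LamPlus_fl hx
  have h := (hU.mul hΛ).const_sub 1
  simp only [B.U.fl_zero] at h
  refine h.congr_deriv ?_
  ring

include hx in
/-- **The flow derivative of `secFun` on `{r ≤ 0}`**: `-V' Λ₋ - V Λ₋'`. [folklore] -/
theorem hasDerivAt_secFun_fl_of_rFun_nonpos (hr : B.rFun x ≤ 0) :
    HasDerivAt (fun t => P.secFun (B.U.fl x t))
      (-(-1 + D.err x) * P.LamMinus x - D.faceV x *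
        ((((-1 - D.err x) * D.wMinus x + (1 - D.wMinus x) * deriv (plateauAbs P.c P.ε') (B.sFun x)) * P.mFun x -
          (D.faceU x * D.wMinus x + (1 - D.wMinus x) * P.mFun x) * deriv (plateauAbs P.c P.ε') (B.sFun x)) /
          P.mFun x ^ 2)) 0 := by
  have hev : (fun t => P.secFun (B.U.fl x t)) =ᶠ[𝓝 0] fun t => 1 - D.faceV (B.U.fl x t) * P.LamMinus (B.U.fl x t) := by
    filter_upwards [B.eventually_add_mem_Ioo hx, B.rFun_fl_eventuallyEq_band hx] with t ht hrt
    have hband : |B.sFun (B.U.fl x t)| < B.U.δ := by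
      rw [B.sFun_fl_eq (B.mem_band_U hx) ht]
      have h1 := ht.1; have h2 := ht.2
      rw [B.f_eq_add_sFun] at h1 h2
      rw [abs_lt]; constructor <;> linarith
    rw [P.secFun_of_abs_lt hband, P.bandFormula_of_rFun_nonpos (by rw [hrt]; exact hr)]
  refine HasDerivAt.congr_of_eventuallyEq ?_ hev
  have hV := D.hasDerivAt_faceV_fl hx
  have hΛ := P.hasDerivAt_LamMinus_fl hx
  have h := (hV.mul hΛ).const_sub 1
  simp only [B.U.fl_zero] at h
  refine h.congr_deriv ?_
  ring

end Flow

/-! ### Regularity: no critical points on the band part of the sector off the surface -/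

omit [T2Space X] [CompactSpace X] in
/-- `-1 ≤ m'(s)`. [folklore] -/
theorem neg_one_le_deriv_plateauAbs (s : ℝ) : -1 ≤ deriv (plateauAbs P.c P.ε') s :=
  (abs_le.1 (abs_deriv_plateauAbs_le P.ε'_pos s)).1

/-- `V ≤ 2m`. [folklore] -/
theorem faceV_le_two_mul_mFun (x : X) : D.faceV x ≤ 2 * P.mFun x := by
  have h1 := D.faceV_le x
  have h2 := P.abs_sFun_le_mFun x
  have h3 := P.c_le_mFun x
  linarith [P.κ_le, P.ε'_pos]

/-- `U ≤ 2m`. [folklore] -/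
theorem faceU_le_two_mul_mFun (x : X) : D.faceU x ≤ 2 * P.mFun x := by
  have h1 := D.faceU_le x
  have h2 := P.abs_sFun_le_mFun x
  have h3 := P.c_le_mFun x
  linarith [P.κ_le, P.ε'_pos]

/-- **`secFun` strictly increases along the flow at every point of the sector in the band off
the surface**: the flow derivative is positive (interior points: `flowDeriv_pos`; boundary
points, where one face function vanishes: the derivative is `(1 ± err) Λ > 0`). [folklore] -/
theorem flowDeriv_secFun_pos {x : X} (hx : |B.sFun x| < B.U.δ) (hxs : x ∈ D.sector) (hxF : x ∉ B.surface) :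
    ∃ d : ℝ, 0 < d ∧ HasDerivAt (fun t => P.secFun (B.U.fl x t)) d 0 := by
  have hm := P.mFun_pos x
  have hU0 : 0 ≤ D.faceU x := ((D.mem_sector_iff_face x).1 hxs).1
  have hV0 : 0 ≤ D.faceV x := ((D.mem_sector_iff_face x).1 hxs).2
  have herr := abs_le.1 (P.abs_err_le' x)
  have hdm := P.neg_one_le_deriv_plateauAbs (B.sFun x)
  obtain ⟨hw0, hw1⟩ := D.wPlus_mem x
  obtain ⟨hw0', hw1'⟩ := D.wMinus_mem x
  rcases le_total 0 (B.rFun x) with hr | hr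
  · refine ⟨_, ?_, P.hasDerivAt_secFun_fl_of_rFun_nonneg hx hr⟩
    have hΛ := P.LamPlus_pos hxs hxF hr
    rcases hU0.lt_or_eq with hUpos | hU00
    · -- interior-type point on this side: `U > 0`; `flowDeriv_pos`
      have hUV : 0 < D.faceU x + D.faceV x := by linarith
      have hUm : D.faceU x ≤ P.mFun x := (D.faceU_le_abs_sFun hr).trans (P.abs_sFun_le_mFun x)
      have h := flowDeriv_pos hU0 hV0 hUV hm hUm (P.faceV_le_two_mul_mFun x) (dU := -1 - D.err x)
        (dV := -1 + D.err x) (dm := deriv (plateauAbs P.c P.ε') (B.sFun x)) (w := D.wPlus x)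
        (by linarith) (by linarith) hdm hw0 hw1
      have hrw : P.LamPlus x = (D.faceV x * D.wPlus x + (1 - D.wPlus x) * P.mFun x) / P.mFun x := rfl
      rw [hrw]
      linarith
    · -- boundary point: `U = 0`, derivative `(1 + err) Λ₊ > 0`
      rw [← hU00]
      have : 0 < (1 + D.err x) * P.LamPlus x := mul_pos (by linarith) hΛ
      nlinarith
  · refine ⟨_, ?_, P.hasDerivAt_secFun_fl_of_rFun_nonpos hx hr⟩
    have hΛ := P.LamMinus_pos hxs hxF hr
    rcases hV0.lt_or_eq with hVpos | hV00
    · have hUV : 0 < D.faceV x + D.faceU x := by linarith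
      have hVm : D.faceV x ≤ P.mFun x := (D.faceV_le_abs_sFun hr).trans (P.abs_sFun_le_mFun x)
      have h := flowDeriv_pos hV0 hU0 hUV hm hVm (P.faceU_le_two_mul_mFun x) (dU := -1 + D.err x)
        (dV := -1 - D.err x) (dm := deriv (plateauAbs P.c P.ε') (B.sFun x)) (w := D.wMinus x)
        (by linarith) (by linarith) hdm hw0' hw1'
      have hrw : P.LamMinus x = (D.faceU x * D.wMinus x + (1 - D.wMinus x) * P.mFun x) / P.mFun x := rfl
      rw [hrw]
      linarith
    · rw [← hV00]
      have : 0 < (1 - D.err x) * P.LamMinus x := mul_pos (by linarith) hΛ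
      nlinarith

/-- **`secFun` has no critical point on the band part of the sector off the surface** — neither
in the collar (`F₁ < 0`) nor on `∂X₁ ∖ F` (`F₁ = 0`). [cite: GayKirby2016, §4, Lemma 14] -/
theorem not_isMCriticalPt_secFun {x : X} (hx : |B.sFun x| < B.U.δ) (hxs : x ∈ D.sector) (hxF : x ∉ B.surface) :
    ¬ IsMCriticalPt (𝓡 4) P.secFun x := by
  obtain ⟨d, hd, hderiv⟩ := P.flowDeriv_secFun_pos hx hxs hxF
  exact not_isMCriticalPt_of_hasDerivAt_comp ((P.contMDiffAt_secFun hxs).mdifferentiableAt (by simp))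
    (B.U.fl_zero x) ((B.contMDiff_fl_right x).mdifferentiableAt (by simp)) hderiv hd.ne'

end SectorOneParams


end BevelData

end BiCollar

end Literature.Topology.FourManifolds

end
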